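import Summits.BirchSwinnertonDyer.BirchSwinnertonDyer.Theorems.SylvesterTwoHeegnerIndexThmCDescentStep
import Literature.NumberTheory.EllipticCurves.HeegnerPointsGaloisDescent
import HarnessLib

/-!
# Route `SylvesterTwoHeegnerIndex` (rung K7t), THEOREM C step (C-d)₂: the identification
# `E₁(L)^{σ = [ω]} ≅ E_p(K)` READ OFF for Hu–Shu–Yin's curves `E_n : y² = x³ − 432n²`, with GALOIS DESCENT

HONEST FRAMING (cell b2b-bsdres, seat x1b GEN 51 = O12 class lead; file `--supports
stmt-BirchSwinnertonDyer-19802 --as helper`, the K7t crux r201 `HSYPointTwoDivisibleSevenModNine` =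
the cell's THEOREM C). Third file of the cubic-twist series (`…ThmCCubicTwistDescent.lean` §§0–2,
`…ThmCDescentStep.lean` §§3–4): the abstract statements read off for the curves the memo means —
`E₁ = cubeSumCurve 1 : y² = x³ − 432` and `E_p = cubeSumCurve p : y² = x³ − 432p²` ([HuShuYin2019] p. 4),
base-changed to any field `L` of characteristic `0` containing `c = ∛p` — with the Galois action
Mathlib's `Affine.Point.map`, and the last clause of [HuShuYin2019] p. 8 «… identified with `E_p(K)`»
supplied by the tree's PROVED Galois descent `exists_map_eq_of_forall_map_galois_eq`
(`HeegnerPointsGaloisDescent`): for a Galois extension `L/K` of characteristic-`0` fields with `ω ∈ K`,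
`c ∈ L`, `c³ = p`:

* §5 `(cubeSumCurve n)_L` is a Mordell equation with `a₆ = −432n²`; `a₆(E_p) = c⁶·a₆(E₁)`
  (`cubeSumCurve_baseChange_a₆_twist`) — so §§0–4 apply verbatim to `E₁ ↦ E_p`;
* §6 every `τ ∈ Gal(L/K)` moves `c` by a cube root of unity `1, ω, ω²` (`galois_map_cbrt`), and the
  EIGEN-CONDITION «`τ P = [ζ_τ]P` whenever `τ c = ζ_τ c`» on `P ∈ E₁(L)` makes `φ P ∈ E_p(L)` FIXED by
  `Gal(L/K)` (`map_twistMap_eq_self_of_eigen`), hence **`exists_point_eq_twistMap_of_eigen`**: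
  `φ P` is (the image of) a point of `E_p(K)`; in the cyclic case `Gal(L/K) = {1, σ, σ²}`, `σ c = ωc`
  (the memo's `L = L_{(p)} = K(∛p)`, `σ = σ_{ω₃}`) the single relation **`σ P = [ω]P`** suffices
  (`exists_point_eq_twistMap_of_generator`) — «`E₁(L_{(p)})^{σ_{ω₃} = ω}` … identified with `E_p(K)`
  under `(x,y) ↦ ((∛p)²x, py)`», one point at a time.

NO definition, NO named fact, NO sorry; axioms standard. WHAT THIS IS NOT: not THEOREM C (memo §40.2:
(C-a), (C-b)₁, (C-b)₂ and Hu–Shu–Yin's printed laws Thm 2.3 (1) / Cor 2.5 stay PRINT/CELL); it does not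
construct `L_{(p)}`, `P₀`, `R′` (CM points — no tree carrier); nothing about `Ш`; closes no item; nothing
booked; no label moves. References: MEMO-bsd-cm-two v2.8 §15.5 (C-d), §40.1; [HuShuYin2019] pp. 4, 8;
[SilvermanAEC2009] I.§1, VIII.§1 (Galois descent), X.5.4.
-/

set_option autoImplicit false
-- the Summit-side namespace `Summit.BirchSwinnertonDyer.BirchSwinnertonDyer.…` (summit = problem) is mandated by D-0017
set_option linter.dupNamespace false

noncomputable section

open scoped Classical

open WeierstrassCurve WeierstrassCurve.Affine WeierstrassCurve.Affine.Point

namespace Summit.BirchSwinnertonDyer.BirchSwinnertonDyer.Theorems.SylvesterTwoThmCTwist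

open SylvesterTwoCMNormForm SylvesterTwoThmCTorsion
open Literature.NumberTheory.EllipticCurves.HuShuYin2019 (cubeSumCurve)

/-! ## §5 `E_n/L = (cubeSumCurve n).baseChange L` is `y² = x³ − 432n²`; `E_p` is the `c⁶`-twist of `E₁` -/

section Curves

variable {L : Type*} [Field L] [CharZero L]

/-- `E_n/L` has `a₁ = 0`. [cite: HuShuYin2019, p. 4] -/
theorem cubeSumCurve_baseChange_a₁ (n : ℚ) : ((cubeSumCurve n).baseChange L).a₁ = 0 := by
  simp [WeierstrassCurve.baseChange, cubeSumCurve]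

/-- `E_n/L` has `a₂ = 0`. [cite: HuShuYin2019, p. 4] -/
theorem cubeSumCurve_baseChange_a₂ (n : ℚ) : ((cubeSumCurve n).baseChange L).a₂ = 0 := by
  simp [WeierstrassCurve.baseChange, cubeSumCurve]

/-- `E_n/L` has `a₃ = 0`. [cite: HuShuYin2019, p. 4] -/
theorem cubeSumCurve_baseChange_a₃ (n : ℚ) : ((cubeSumCurve n).baseChange L).a₃ = 0 := by
  simp [WeierstrassCurve.baseChange, cubeSumCurve]

/-- `E_n/L` has `a₄ = 0`. [cite: HuShuYin2019, p. 4] -/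
theorem cubeSumCurve_baseChange_a₄ (n : ℚ) : ((cubeSumCurve n).baseChange L).a₄ = 0 := by
  simp [WeierstrassCurve.baseChange, cubeSumCurve]

/-- `E_n/L` has `a₆ = −432n²`. [cite: HuShuYin2019, p. 4] -/
theorem cubeSumCurve_baseChange_a₆ (n : ℚ) :
    ((cubeSumCurve n).baseChange L).a₆ = -432 * (n : L) ^ 2 := by
  simp [WeierstrassCurve.baseChange, cubeSumCurve]

/-- `E₁/L` has `a₆ = −432`. [cite: HuShuYin2019, p. 4] -/
theorem cubeSumCurve_one_baseChange_a₆ : ((cubeSumCurve 1).baseChange L).a₆ = -432 := by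
  rw [cubeSumCurve_baseChange_a₆]; push_cast; ring

/-- **`E_p` is the `c⁶`-twist of `E₁`**: `a₆(E_p) = −432p² = c⁶·a₆(E₁)` when `c³ = p` — the hypothesis
`h6′` of §§1–4. [cite: HuShuYin2019, p. 8] -/
theorem cubeSumCurve_baseChange_a₆_twist {c : L} {p : ℚ} (hc : c ^ 3 = (p : L)) :
    ((cubeSumCurve p).baseChange L).a₆ = c ^ 6 * ((cubeSumCurve 1).baseChange L).a₆ := by
  rw [cubeSumCurve_baseChange_a₆, cubeSumCurve_one_baseChange_a₆, ← hc]
  ring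

/-- `c ≠ 0` when `c³ = p ≠ 0`. [folklore] -/
theorem cbrt_ne_zero {c : L} {p : ℚ} (hc : c ^ 3 = (p : L)) (hp : p ≠ 0) : c ≠ 0 := by
  rintro rfl
  apply hp
  have h : ((p : ℚ) : L) = 0 := by rw [← hc]; ring
  exact_mod_cast h

end Curves

/-! ## §6 Galois descent: `φ P ∈ E_p(K)` from the eigen-condition on `P ∈ E₁(L)` -/

section Descent

variable {K L : Type*} [Field K] [CharZero K] [Field L] [CharZero L] [Algebra K L]
  {ω₀ : K} {c : L} {p : ℚ} (hω₀ : ω₀ ^ 2 + ω₀ + 1 = 0) (hc : c ^ 3 = (p : L)) (hp : p ≠ 0)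

include hω₀ in
/-- `ω := ω₀` viewed in `L` satisfies `ω² + ω + 1 = 0`. [folklore] -/
theorem omega_algebraMap : (algebraMap K L ω₀) ^ 2 + algebraMap K L ω₀ + 1 = 0 := by
  have h := congrArg (algebraMap K L) hω₀
  rwa [map_add, map_add, map_pow, map_one, _root_.map_zero] at h

omit [CharZero K] [CharZero L] in
include hc in
/-- Every `τ ∈ Aut(L/K)` fixes `c³ = p`. [folklore] -/
theorem galois_map_cube (τ : L ≃ₐ[K] L) : (τ : L →+* L) (c ^ 3) = c ^ 3 := by
  rw [hc]
  exact map_ratCast (τ : L →+* L) p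

include hω₀ hc hp in
/-- **`τ c ∈ {c, ωc, ω²c}` for every `τ ∈ Aut(L/K)`** (`c³ = p ∈ ℚ`, `ω ∈ K`). [folklore] -/
theorem galois_map_cbrt (τ : L ≃ₐ[K] L) :
    τ c = c ∨ τ c = algebraMap K L ω₀ * c ∨ τ c = (algebraMap K L ω₀) ^ 2 * c :=
  map_eq_or_of_map_cube_eq (omega_algebraMap (L := L) hω₀) (τ : L →+* L) (cbrt_ne_zero hc hp)
    (galois_map_cube hc τ)

omit [CharZero K] [CharZero L] in
/-- `τ ∈ Aut(L/K)` fixes `ω ∈ K`. [folklore] -/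
theorem galois_map_omega (τ : L ≃ₐ[K] L) : (τ : L →+* L) (algebraMap K L ω₀) = algebraMap K L ω₀ :=
  τ.commutes ω₀

variable {θ : ((cubeSumCurve 1).baseChange L).toAffine.Point → ((cubeSumCurve 1).baseChange L).toAffine.Point}
  (hθ0 : θ 0 = 0)
  (hθ : ∀ (x y : L) (h : ((cubeSumCurve 1).baseChange L).toAffine.Nonsingular x y),
    θ (.some x y h) = .some (algebraMap K L ω₀ * x) y
      (nonsingular_rootMul (cubeSumCurve_baseChange_a₁ 1) (cubeSumCurve_baseChange_a₂ 1)
        (cubeSumCurve_baseChange_a₃ 1) (cubeSumCurve_baseChange_a₄ 1)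
        (omega_pow_three (omega_algebraMap (L := L) hω₀)) h))
  {φ : ((cubeSumCurve 1).baseChange L).toAffine.Point → ((cubeSumCurve p).baseChange L).toAffine.Point}
  (hφ0 : φ 0 = 0)
  (hφ : ∀ (x y : L) (h : ((cubeSumCurve 1).baseChange L).toAffine.Nonsingular x y),
    φ (.some x y h) = .some (c ^ 2 * x) (c ^ 3 * y)
      (nonsingular_twist (cbrt_ne_zero hc hp) (cubeSumCurve_baseChange_a₁ 1)
        (cubeSumCurve_baseChange_a₂ 1) (cubeSumCurve_baseChange_a₃ 1) (cubeSumCurve_baseChange_a₄ 1)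
        (cubeSumCurve_baseChange_a₁ p) (cubeSumCurve_baseChange_a₂ p) (cubeSumCurve_baseChange_a₃ p)
        (cubeSumCurve_baseChange_a₄ p) (cubeSumCurve_baseChange_a₆_twist hc) h))

include hθ in
/-- `[ω]² = θ ∘ θ` acts by `(x, y) ↦ (ω²x, y)`. [folklore] -/
theorem theta_theta_some (x y : L) (h : ((cubeSumCurve 1).baseChange L).toAffine.Nonsingular x y) :
    θ (θ (.some x y h)) = .some ((algebraMap K L ω₀) ^ 2 * x) y
      (nonsingular_rootMul (cubeSumCurve_baseChange_a₁ 1) (cubeSumCurve_baseChange_a₂ 1)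
        (cubeSumCurve_baseChange_a₃ 1) (cubeSumCurve_baseChange_a₄ 1)
        (sq_pow_three_eq_one (omega_pow_three (omega_algebraMap (L := L) hω₀))) h) := by
  rw [hθ, hθ]
  simp only [Affine.Point.some.injEq, and_true]
  ring

include hc hp hφ0 hφ in
/-- **Case `τ c = c`: `τ(φ P) = φ(τ P)`** (the scaling is then `τ`-equivariant). [cite: SilvermanAEC2009, Prop. X.5.4] -/
theorem map_twistMap_of_map_cbrt_eq (τ : L ≃ₐ[K] L) (hτ : τ c = c)
    (P : ((cubeSumCurve 1).baseChange L).toAffine.Point) :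
    Affine.Point.map (τ : L →ₐ[K] L) (φ P) = φ (Affine.Point.map (τ : L →ₐ[K] L) P) := by
  rcases P with _ | ⟨x, y, h⟩
  · show Affine.Point.map (τ : L →ₐ[K] L) (φ 0) = φ (Affine.Point.map (τ : L →ₐ[K] L) 0)
    rw [hφ0, Affine.Point.map_zero, Affine.Point.map_zero, hφ0]
  · have hτ' : (τ : L →ₐ[K] L) c = c := hτ
    rw [hφ, Affine.Point.map_some, Affine.Point.map_some, hφ]
    simp only [map_mul, map_pow, hτ']

include hω₀ hc hp hθ0 hθ hφ0 hφ in
/-- **`φ P` is FIXED by every `τ ∈ Aut(L/K)` under the eigen-condition on `P`**: if `τ P = P`,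
`τ P = [ω]P`, `τ P = [ω]²P` according as `τ c = c, ωc, ω²c`, then `τ(φ P) = φ P` — §2's criterion
`map_twistMap_eq_self_iff` for `ζ = ω, ω²` (with `θ`, `θ∘θ`) and `map_twistMap_of_map_cbrt_eq` for
`ζ = 1`. [cite: HuShuYin2019, p. 8] -/
theorem map_twistMap_eq_self_of_eigen (τ : L ≃ₐ[K] L) (P : ((cubeSumCurve 1).baseChange L).toAffine.Point)
    (h₁ : τ c = c → Affine.Point.map (τ : L →ₐ[K] L) P = P)
    (hω : τ c = algebraMap K L ω₀ * c → Affine.Point.map (τ : L →ₐ[K] L) P = θ P)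
    (hω2 : τ c = (algebraMap K L ω₀) ^ 2 * c → Affine.Point.map (τ : L →ₐ[K] L) P = θ (θ P)) :
    Affine.Point.map (τ : L →ₐ[K] L) (φ P) = φ P := by
  have hc0 := cbrt_ne_zero hc hp
  have hω3 := omega_pow_three (omega_algebraMap (L := L) hω₀)
  have hσ6 : (τ : L →+* L) ((cubeSumCurve 1).baseChange L).a₆ = ((cubeSumCurve 1).baseChange L).a₆ :=
    map_a₆_EOne cubeSumCurve_one_baseChange_a₆
  rcases galois_map_cbrt hω₀ hc hp τ with hτ | hτ | hτ
  · rw [map_twistMap_of_map_cbrt_eq hc hp hφ0 hφ τ hτ, h₁ hτ]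
  · exact (map_twistMap_eq_self_iff hc0 (cubeSumCurve_baseChange_a₁ 1) (cubeSumCurve_baseChange_a₂ 1)
      (cubeSumCurve_baseChange_a₃ 1) (cubeSumCurve_baseChange_a₄ 1) (cubeSumCurve_baseChange_a₁ p)
      (cubeSumCurve_baseChange_a₂ p) (cubeSumCurve_baseChange_a₃ p) (cubeSumCurve_baseChange_a₄ p)
      (cubeSumCurve_baseChange_a₆_twist hc) hφ0 hφ hω3 (σ := (τ : L →+* L)) hτ hσ6
      (s := Affine.Point.map (τ : L →ₐ[K] L)) (Affine.Point.map_zero _)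
      (fun x y h => Affine.Point.map_some _ h)
      (s' := Affine.Point.map (τ : L →ₐ[K] L)) (Affine.Point.map_zero _)
      (fun x y h => Affine.Point.map_some _ h) hθ0 hθ P).mpr (hω hτ)
  · exact (map_twistMap_eq_self_iff hc0 (cubeSumCurve_baseChange_a₁ 1) (cubeSumCurve_baseChange_a₂ 1)
      (cubeSumCurve_baseChange_a₃ 1) (cubeSumCurve_baseChange_a₄ 1) (cubeSumCurve_baseChange_a₁ p)
      (cubeSumCurve_baseChange_a₂ p) (cubeSumCurve_baseChange_a₃ p) (cubeSumCurve_baseChange_a₄ p)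
      (cubeSumCurve_baseChange_a₆_twist hc) hφ0 hφ (sq_pow_three_eq_one hω3) (σ := (τ : L →+* L)) hτ
      hσ6 (s := Affine.Point.map (τ : L →ₐ[K] L)) (Affine.Point.map_zero _)
      (fun x y h => Affine.Point.map_some _ h)
      (s' := Affine.Point.map (τ : L →ₐ[K] L)) (Affine.Point.map_zero _)
      (fun x y h => Affine.Point.map_some _ h) (θ := fun Q => θ (θ Q)) (by simp only [hθ0])
      (fun x y h => theta_theta_some hω₀ hθ x y h) P).mpr (hω2 hτ)

include hω₀ hc hp hθ0 hθ hφ0 hφ in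
/-- **THE IDENTIFICATION WITH `E_p(K)` (Galois descent).** `L/K` Galois of characteristic `0`, `ω ∈ K`,
`c ∈ L` with `c³ = p ≠ 0`; `[ω]` ANY map on `E₁(L)` acting by `(x,y) ↦ (ωx, y)`, `φ` ANY map
`E₁(L) → E_p(L)` acting by `(x,y) ↦ (c²x, c³y)`. If `P ∈ E₁(L)` satisfies the eigen-condition
(`τ P = [ζ_τ]P` whenever `τ c = ζ_τ c`, `τ ∈ Gal(L/K)`), then **`φ P` comes from a point of `E_p(K)`**
(tree `exists_map_eq_of_forall_map_galois_eq`). [cite: HuShuYin2019, p. 8] -/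
theorem exists_point_eq_twistMap_of_eigen [IsGalois K L] (P : ((cubeSumCurve 1).baseChange L).toAffine.Point)
    (hP : ∀ τ : L ≃ₐ[K] L,
      (τ c = c → Affine.Point.map (τ : L →ₐ[K] L) P = P) ∧
      (τ c = algebraMap K L ω₀ * c → Affine.Point.map (τ : L →ₐ[K] L) P = θ P) ∧
      (τ c = (algebraMap K L ω₀) ^ 2 * c → Affine.Point.map (τ : L →ₐ[K] L) P = θ (θ P))) :
    ∃ Y₀ : ((cubeSumCurve p).baseChange K).toAffine.Point,
      Affine.Point.map (algebraMap K L).toRatAlgHom Y₀ = φ P :=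
  Literature.NumberTheory.EllipticCurves.exists_map_eq_of_forall_map_galois_eq (cubeSumCurve p)
    fun τ => map_twistMap_eq_self_of_eigen hω₀ hc hp hθ0 hθ hφ0 hφ τ P (hP τ).1 (hP τ).2.1 (hP τ).2.2

include hθ0 hθ in
/-- `[ω]` commutes with every `τ ∈ Aut(L/K)` (`ω ∈ K`). [folklore] -/
theorem map_theta_comm (τ : L ≃ₐ[K] L) (P : ((cubeSumCurve 1).baseChange L).toAffine.Point) :
    Affine.Point.map (τ : L →ₐ[K] L) (θ P) = θ (Affine.Point.map (τ : L →ₐ[K] L) P) := by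
  rcases P with _ | ⟨x, y, h⟩
  · show Affine.Point.map (τ : L →ₐ[K] L) (θ 0) = θ (Affine.Point.map (τ : L →ₐ[K] L) 0)
    rw [hθ0, Affine.Point.map_zero, hθ0]
  · rw [hθ, Affine.Point.map_some, Affine.Point.map_some, hθ]
    simp only [Affine.Point.some.injEq, map_mul, and_true]
    rw [AlgHom.commutes]

/-- `τ²` acts on points as `τ ∘ τ`. [folklore] -/
theorem map_mul_self (τ : L ≃ₐ[K] L) {n : ℚ} (P : ((cubeSumCurve n).baseChange L).toAffine.Point) :
    Affine.Point.map ((τ * τ : L ≃ₐ[K] L) : L →ₐ[K] L) P =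
      Affine.Point.map (τ : L →ₐ[K] L) (Affine.Point.map (τ : L →ₐ[K] L) P) := by
  rcases P with _ | ⟨x, y, h⟩ <;> rfl

include hω₀ hc hp hθ0 hθ hφ0 hφ in
/-- **THE CYCLIC CASE — Hu–Shu–Yin's identification verbatim, one point at a time.** `L/K` Galois with
`Gal(L/K) = {1, σ, σ²}`, `σ c = ωc` (the memo's `L = L_{(p)} = K(∛p)`, `σ = σ_{ω₃}`): every
`P ∈ E₁(L)^{σ = [ω]}` (i.e. `σ P = [ω]P`) has `φ P ∈ E_p(K)` — «`E₁(L_{(p)})^{σ_{ω₃} = ω}` which is identified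
with `E_p(K)` under the isomorphism `(x,y) ↦ ((∛p)²x, py)`». [cite: HuShuYin2019, p. 8] -/
theorem exists_point_eq_twistMap_of_generator [IsGalois K L] (σ : L ≃ₐ[K] L)
    (hσc : σ c = algebraMap K L ω₀ * c) (hgen : ∀ τ : L ≃ₐ[K] L, τ = 1 ∨ τ = σ ∨ τ = σ * σ)
    (P : ((cubeSumCurve 1).baseChange L).toAffine.Point)
    (hP : Affine.Point.map (σ : L →ₐ[K] L) P = θ P) :
    ∃ Y₀ : ((cubeSumCurve p).baseChange K).toAffine.Point,
      Affine.Point.map (algebraMap K L).toRatAlgHom Y₀ = φ P := by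
  have hc0 := cbrt_ne_zero hc hp
  have hωL := omega_algebraMap (L := L) hω₀
  have hω0 : algebraMap K L ω₀ ≠ 0 := omega_ne_zero hωL
  have hω1 : algebraMap K L ω₀ ≠ 1 := omega_ne_one_of_three_ne_zero hωL (by norm_num)
  -- `σ²c = ω²c`, `σ²P = [ω]²P`
  have hσ2c : (σ * σ) c = (algebraMap K L ω₀) ^ 2 * c := by
    rw [AlgEquiv.mul_apply, hσc, map_mul, AlgEquiv.commutes, hσc]; ring
  have hσ2P : Affine.Point.map ((σ * σ : L ≃ₐ[K] L) : L →ₐ[K] L) P = θ (θ P) := by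
    rw [map_mul_self, hP, map_theta_comm hω₀ hθ0 hθ, hP]
  refine exists_point_eq_twistMap_of_eigen hω₀ hc hp hθ0 hθ hφ0 hφ P fun τ => ?_
  rcases hgen τ with rfl | rfl | rfl
  · refine ⟨fun _ => Affine.Point.map_id P, fun h => ?_, fun h => ?_⟩
    · exfalso; apply hω1
      have e : (algebraMap K L ω₀ - 1) * c = 0 := by
        have h' : c = algebraMap K L ω₀ * c := h
        linear_combination -h'
      have := (mul_eq_zero.mp e).resolve_right hc0
      linear_combination this
    · exfalso
      have h' : c = (algebraMap K L ω₀) ^ 2 * c := h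
      have e : ((algebraMap K L ω₀) ^ 2 - 1) * c = 0 := by linear_combination -h'
      have h2 := (mul_eq_zero.mp e).resolve_right hc0
      -- `ω² = 1` with `ω³ = 1` forces `ω = 1`
      apply hω1
      have hω3 := omega_pow_three hωL
      linear_combination (-(algebraMap K L ω₀)) * h2 + hω3
  · refine ⟨fun h => ?_, fun _ => hP, fun h => ?_⟩
    · exfalso; apply hω1
      rw [hσc] at h
      have e : (algebraMap K L ω₀ - 1) * c = 0 := by linear_combination h
      have := (mul_eq_zero.mp e).resolve_right hc0
      linear_combination this
    · exfalso; apply hω1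
      rw [hσc] at h
      have e : (algebraMap K L ω₀) * (1 - algebraMap K L ω₀) * c = 0 := by linear_combination h
      rcases mul_eq_zero.mp e with e | e
      · rcases mul_eq_zero.mp e with e | e
        · exact absurd e hω0
        · linear_combination -e
      · exact absurd e hc0
  · refine ⟨fun h => ?_, fun h => ?_, fun _ => hσ2P⟩
    · exfalso
      rw [hσ2c] at h
      have e : ((algebraMap K L ω₀) ^ 2 - 1) * c = 0 := by linear_combination h
      have h2 := (mul_eq_zero.mp e).resolve_right hc0
      apply hω1
      have hω3 := omega_pow_three hωL
      linear_combination (-(algebraMap K L ω₀)) * h2 + hω3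
    · exfalso; apply hω1
      rw [hσ2c] at h
      have e : (algebraMap K L ω₀) * (algebraMap K L ω₀ - 1) * c = 0 := by linear_combination h
      rcases mul_eq_zero.mp e with e | e
      · rcases mul_eq_zero.mp e with e | e
        · exact absurd e hω0
        · linear_combination e
      · exact absurd e hc0

end Descent

end Summit.BirchSwinnertonDyer.BirchSwinnertonDyer.Theorems.SylvesterTwoThmCTwist

end
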